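import Summits.QuantumFields.YangMills.Theorems.BalabanUVNodesN14LawChannel
import Literature.Probability.Distributions.GaussianCoordinateMoments
import Mathlib.Probability.Distributions.Gaussian.Multivariate
import Mathlib.Analysis.InnerProductSpace.Trace

/-!
# BalabanUVNodes ∕ node N14 = NE1′ — THE LAW CHANNEL'S LOCATED INPUT (F2′) AT `u = s = 0`, FIRST STOREY: conditioning on the base of a PRODUCT law
# (cross terms and the fluctuation part drop out of the conditioned one-step defect) and the WHITENED GAUSSIAN QUADRATIC CARICATURE
# (`∫|γ[D | unit field] − γ[D]| dγ ≤ min(2·‖Q_UU‖·dim U, √2·‖Q_UU‖_HS)`: the defect COMPRESSED to the unit-field block, while `sup|D| = ∞`)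

Cell `pub-ymgap`, HUMAN RULING D-0062, seat `pub-ymgap-dag-n14-c` (R134 ACCELERATION, strategy s1), generation 6; route `Summits/QuantumFields/YangMills/Theses/BalabanUVNodes.lean`
rev 16∕17 (cluster K3‴ `SpineGivenEndpointR13` = stmt-QuantumFields-19912, `--supports … --as helper`); venue ruling R424 (`YangMills/Theorems`, namespace
`YMDAG.N14.LawChannelGaussian`).  ADDITIVE — imports this lineage's P `…N14LawChannel` (§3 of P consumes the letter computed here), the tree's
`Literature/Probability/Distributions/GaussianCoordinateMoments` (`integral_norm_sq_stdGaussian`, `integral_coord_mul_coord_stdGaussian`, Isserlis at order four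
`integral_quartForm_stdGaussian`, `norm_sq_eq_sum_coord_sq` — PROVED there, CITED), Mathlib's multivariate standard Gaussian and `LinearMap.trace_eq_sum_inner`;
THEOREMS ONLY (0 `def`), modifies nothing.  SOURCE OF RECORD: LENS control v4.0 §N14 row s11 (planner seat `ym-lens-BalabanUVNodes-control` g4, pub-ymgap INBOX
2026-08-27T04:26Z: «N14 successor … first storey: the linearised GAUSSIAN model»; v5.0 census V52 «no O(a²) Gaussian rung in the tree») and this lineage's g5 design note
`pub-ymgap-dag-n14-c/DOOR-s11-gaussian-first-storey.md` (CLAIM 1 ∕ CLAIM 2).  Memo rows only; the lens files nothing.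

THE LETTER BEING COMPUTED.  P §3 `YMDAG.N14.LawChannel.cauchySeq_genFun_of_condDefectTower` makes the T⁴ Cauchy property on the template follow from ONE summable scalar
family `b K ≥ ∫ |μ_{u,s}[D K | m K] − μ_{u,s}[D K]| dμ_{u,s}` — the L¹-OSCILLATION OF THE CONDITIONED ONE-STEP DEFECT given the unit-field σ-algebra `m K` along the
interpolated laws `μ_{u,s} = (μ K).tilted (s·F K + u·D K)`.  At `u = s = 0` (`μ_{0,0} = μ K`), with the unit field INDEPENDENT of the fluctuations (`μ K = μU ⊗ μV`,
`m K = σ(fst)`), this file computes that letter in closed form: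
* §1 [folklore] CONDITIONING ON THE BASE OF A PRODUCT LAW: ★ `condExp_prod_fst_ae_eq` (`(μU ⊗ μV)[D | σ(fst)] = (x,z) ↦ ∫ D(x,z′) dμV(z′)` a.e. — Fubini + Mathlib's
  `ae_eq_condExp_of_forall_setIntegral_eq`); ★ `condExp_prod_fst_of_fibreMeanZero` (CLAIM 1: for `D = a∘fst + b + c∘snd` whose CROSS TERM has fibre mean zero,
  `∫ b(x,·) dμV = 0`, the conditioned defect is `a∘fst + ∫c dμV` a.e. — cross term AND fluctuation part drop out, the latter into a constant); `integral_crossFree_prod`;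
  `condExp_sub_integral_ae_eq_block` (the CENTRED conditioned defect IS the centred block part `a∘fst − ∫a`); ★ `integral_abs_condExp_sub_integral_eq` (P §3's letter
  at `u = s = 0` EQUALS `∫|a − ∫a dμU| dμU`, the L¹-oscillation of the block part ALONE); `integral_abs_sub_integral_le_two_mul` (`≤ 2∫|a|`).
* §2 [folklore ∘ Isserlis] GAUSSIAN MOMENTS OF A BOUNDED QUADRATIC FORM `a(u) = ⟪u, Qu⟫` under `γ_U = stdGaussian U`: `inner_clm_self_eq_sum_coord` ∕ `sq_inner_clm_self_eq_sum_four`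
  (the form and its square in orthonormal coordinates), `integral_quadForm_stdGaussian_eq_sum` ∕ `_eq_trace` (`∫a dγ = tr Q`), `integral_norm_sq_stdGaussian_eq_finrank`
  (`∫‖u‖² = dim U`), `integral_sq_quadForm_stdGaussian` (Isserlis: `∫a² = (tr Q)² + ‖Q‖²_HS + tr(Q²)`), ★ `integral_sq_quadForm_sub_stdGaussian` (VARIANCE `= ‖Q‖²_HS + tr(Q²)`),
  `sum_mul_transpose_le_sum_sq` (`tr(Q²) ≤ ‖Q‖²_HS`), `sum_sq_inner_eq_sum_norm_sq` (Parseval: `‖Q‖²_HS = Σₖ‖Q bₖ‖²`), `integral_abs_le_sqrt_integral_sq` (`L¹ ≤ L²`),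
  ★ `integral_abs_quadForm_sub_le_two_mul` (`osc(a) ≤ 2‖Q‖·dim U`), ★ `integral_abs_quadForm_sub_le_sqrt` (`osc(a) ≤ √2·‖Q‖_HS`, dimension-free).
* §3 [folklore] THE WHITENED GAUSSIAN QUADRATIC CARICATURE (DOOR-s11): `γ := stdGaussian U ⊗ stdGaussian V` (unit-field × fluctuation directions, independent after
  whitening — a general centred Gaussian fine field with a linear block-averaging map reduces to this by the minimiser ∕ fluctuation decomposition; said, not typed), defect
  `D(u,z) = ⟪u, Q₁u⟫ + 2⟪u, Rz⟫ + ⟪z, Q₂z⟫` (`Q₁ = PQP` the UU-block, `R` the cross block, `Q₂` the fluctuation block): `integral_inner_clm_stdGaussian_eq_zero` (Mathlib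
  `integral_strongDual_stdGaussian`), ★ `condExp_quadDefect_ae_eq` ∕ `_trace` (CLAIM 1: `γ[D | σ(fst)] = ⟪u, Q₁u⟫ + tr Q₂` a.e.), `integral_quadDefect_eq_trace`
  (`γ[D] = tr Q₁ + tr Q₂`), `integral_abs_condExp_quadDefect_sub_eq`, ★★ `integral_abs_condExp_quadDefect_sub_le` (CLAIM 2: `≤ 2·‖Q₁‖·dim U`) and ★★
  `integral_abs_condExp_quadDefect_sub_le_hs` (CLAIM 2 DIMENSION-FREE: `≤ √(2·Σₖ‖Q₁bₖ‖²) = √2·‖PQP‖_HS` in any orthonormal basis of the unit-field directions).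

READING (honest).  P §3's located input at `u = s = 0` is the size of the one-step defect COMPRESSED TO THE UNIT-FIELD BLOCK — `‖PQP‖_op·dim U` (`dim U` = unit-lattice
volume, FIXED in the one-finite-T⁴ programme) or, dimension-free, `√2·‖PQP‖_HS` («irrelevance» of the one-step correction seen from the unit lattice); the cross block is
invisible at this order and the fluctuation block entirely; `sup|D| = ∞` for any nonzero quadratic `D`, so F2's sup-keying of the defect on `Ω_K` (lens-decomp v6) is not even
finite here, whereas (F2′) is.  Along `u > 0` the tilted law `γ.tilted (u·D)` is Gaussian with correlated blocks (the cross block re-enters at order `u·‖R‖²`), and with the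
record's cosine source the laws leave the Gaussian class — NOT typed; «certify ‖PQP‖ ∼ L^{−2K}» on Bałaban's averaging covariances is row s11's numerics half (0 kit here).

WHAT THIS IS NOT.  Everything here is PROVED (0 `sorry`, 0 named facts); folklore probability on an ABSTRACT product law ∕ the whitened Gaussian caricature; the one-step
log-density defect of Bałaban's runs, its block structure and the size of its compressed block are NODE O ∕ NE5–NE7 objects and estimates — nothing of Bałaban's is
instantiated or asserted; N14 NOT discharged (at the record N14's binder closes BY NAME from §N19's class-level input — LENS control v5.0; the dressed tower of record is
NODE O's object); count-neutral.  One finite four-torus programme at fixed ε; NOT ℝ⁴, NOT OS, NOT a mass gap, NOT Clay.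
-/

noncomputable section

namespace YMDAG.N14.LawChannelGaussian

open MeasureTheory ProbabilityTheory Set Filter
open scoped ENNReal NNReal RealInnerProductSpace
open Literature.Probability.Distributions (integral_coord_mul_coord_stdGaussian integrable_coord_mul_coord_stdGaussian integral_norm_sq_stdGaussian
  integrable_coord_four_stdGaussian integral_quartForm_stdGaussian norm_sq_eq_sum_coord_sq)

/-! ## §1 Conditioning on the base of a product law: cross terms and the fluctuation part drop out of the conditioned defect -/
section Product

variable {U V : Type*} [mU : MeasurableSpace U] [mV : MeasurableSpace V] {μU : Measure U} {μV : Measure V}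
  [IsProbabilityMeasure μU] [IsProbabilityMeasure μV]

/-- **CONDITIONING ON THE BASE OF A PRODUCT LAW** [folklore]: for an integrable, measurable `D` on `U × V` under the product of two probability laws, the
conditional expectation given the base σ-algebra `σ(fst)` is the fibre integral, `(μU ⊗ μV)[D | σ(fst)] = (x, z) ↦ ∫ D(x, z′) dμV(z′)` a.e. (Fubini on the base
cylinders `t ×ˢ univ` + Mathlib's characterisation of the conditional expectation). -/
theorem condExp_prod_fst_ae_eq {D : U × V → ℝ} (hDm : Measurable D) (hDi : Integrable D (μU.prod μV)) :
    (μU.prod μV)[D | mU.comap Prod.fst] =ᵐ[μU.prod μV] fun p => ∫ z, D (p.1, z) ∂μV := by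
  have hgi : Integrable (fun x => ∫ z, D (x, z) ∂μV) μU := hDi.integral_prod_left
  have hgsm : StronglyMeasurable (fun x => ∫ z, D (x, z) ∂μV) := hDm.stronglyMeasurable.integral_prod_right'
  have hgpi : Integrable (fun p : U × V => ∫ z, D (p.1, z) ∂μV) (μU.prod μV) := hgi.comp_fst μV
  refine (ae_eq_condExp_of_forall_setIntegral_eq (m := mU.comap Prod.fst) measurable_fst.comap_le hDi (fun s _ _ => hgpi.integrableOn) ?_ ?_).symm
  · rintro s ⟨t, ht, rfl⟩ _
    have e : (Prod.fst : U × V → U) ⁻¹' t = t ×ˢ (univ : Set V) := by ext p; simp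
    rw [e, setIntegral_prod _ hgpi.integrableOn, setIntegral_prod _ hDi.integrableOn]
    refine setIntegral_congr_fun ht fun x _ => ?_
    simp only [Measure.restrict_univ, integral_const, probReal_univ, smul_eq_mul, one_mul]
  · exact (hgsm.comp_measurable (measurable_iff_comap_le.2 le_rfl)).aestronglyMeasurable

variable {a : U → ℝ} {b : U × V → ℝ} {c : V → ℝ}

/-- **CLAIM 1 — CROSS TERMS AND THE FLUCTUATION PART DROP OUT OF THE CONDITIONED DEFECT** [folklore]: for a defect `D(x,z) = a(x) + b(x,z) + c(z)` on the product
law `μU ⊗ μV` (unit field `x` INDEPENDENT of the fluctuations `z`) whose cross term has FIBRE MEAN ZERO, `∫ b(x,z) dμV(z) = 0` for every `x` (e.g. `b` bilinear and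
`μV` centred), the conditioned defect is the block part plus a constant: `(μU ⊗ μV)[D | σ(fst)] = (x,z) ↦ a(x) + ∫ c dμV` a.e. -/
theorem condExp_prod_fst_of_fibreMeanZero (ham : Measurable a) (hai : Integrable a μU) (hbm : Measurable b) (hbi : Integrable b (μU.prod μV))
    (hbx : ∀ x, Integrable (fun z => b (x, z)) μV) (hb0 : ∀ x, ∫ z, b (x, z) ∂μV = 0) (hcm : Measurable c) (hci : Integrable c μV) :
    (μU.prod μV)[fun p => a p.1 + b p + c p.2 | mU.comap Prod.fst] =ᵐ[μU.prod μV] fun p => a p.1 + ∫ z, c z ∂μV := by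
  have hDm : Measurable fun p : U × V => a p.1 + b p + c p.2 := by fun_prop
  refine (condExp_prod_fst_ae_eq hDm (((hai.comp_fst μV).add hbi).add (hci.comp_snd μU))).trans (Eventually.of_forall fun p => ?_)
  show ∫ z, (a p.1 + b (p.1, z) + c z) ∂μV = a p.1 + ∫ z, c z ∂μV
  have i1 : Integrable (fun z => a p.1 + b (p.1, z)) μV := (integrable_const _).add (hbx p.1)
  have e1 : ∫ z, (a p.1 + b (p.1, z) + c z) ∂μV = ∫ z, (a p.1 + b (p.1, z)) ∂μV + ∫ z, c z ∂μV := integral_add i1 hci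
  have e2 : ∫ z, (a p.1 + b (p.1, z)) ∂μV = ∫ _z, a p.1 ∂μV + ∫ z, b (p.1, z) ∂μV := integral_add (integrable_const _) (hbx p.1)
  rw [e1, e2, hb0 p.1, integral_const, probReal_univ, smul_eq_mul, one_mul, add_zero]

/-- The mean of the cross-structured defect: `∫ D d(μU ⊗ μV) = ∫ a dμU + ∫ c dμV` (the cross term integrates to zero fibrewise). [folklore] -/
theorem integral_crossFree_prod (hai : Integrable a μU) (hbi : Integrable b (μU.prod μV)) (hb0 : ∀ x, ∫ z, b (x, z) ∂μV = 0)
    (hci : Integrable c μV) :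
    ∫ p, (a p.1 + b p + c p.2) ∂(μU.prod μV) = ∫ x, a x ∂μU + ∫ z, c z ∂μV := by
  have e1 : ∫ p, (a p.1 + b p + c p.2) ∂(μU.prod μV) = ∫ p, (a p.1 + b p) ∂(μU.prod μV) + ∫ p : U × V, c p.2 ∂(μU.prod μV) :=
    integral_add ((hai.comp_fst μV).add hbi) (hci.comp_snd μU)
  have e2 : ∫ p, (a p.1 + b p) ∂(μU.prod μV) = ∫ p : U × V, a p.1 ∂(μU.prod μV) + ∫ p, b p ∂(μU.prod μV) := integral_add (hai.comp_fst μV) hbi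
  have e3 : ∫ p, b p ∂(μU.prod μV) = 0 := by rw [integral_prod _ hbi]; simp only [hb0, integral_zero]
  rw [e1, e2, e3, integral_fun_fst, integral_fun_snd, add_zero, probReal_univ, probReal_univ, one_smul, one_smul]

/-- **THE CENTRED CONDITIONED DEFECT IS THE CENTRED BLOCK PART** [folklore]: `(μU ⊗ μV)[D | σ(fst)] − ∫ D = a∘fst − ∫ a dμU` a.e. -/
theorem condExp_sub_integral_ae_eq_block (ham : Measurable a) (hai : Integrable a μU) (hbm : Measurable b) (hbi : Integrable b (μU.prod μV))
    (hbx : ∀ x, Integrable (fun z => b (x, z)) μV) (hb0 : ∀ x, ∫ z, b (x, z) ∂μV = 0) (hcm : Measurable c) (hci : Integrable c μV) :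
    (fun p => ((μU.prod μV)[fun p => a p.1 + b p + c p.2 | mU.comap Prod.fst]) p - ∫ q, (a q.1 + b q + c q.2) ∂(μU.prod μV))
      =ᵐ[μU.prod μV] fun p => a p.1 - ∫ x, a x ∂μU := by
  filter_upwards [condExp_prod_fst_of_fibreMeanZero ham hai hbm hbi hbx hb0 hcm hci] with p hp
  rw [hp, integral_crossFree_prod hai hbi hb0 hci]; ring

/-- **P §3's LETTER AT `u = s = 0` IS THE L¹-OSCILLATION OF THE BLOCK PART ALONE** [folklore]:
`∫ |(μU ⊗ μV)[D | σ(fst)] − ∫ D| d(μU ⊗ μV) = ∫ |a − ∫ a dμU| dμU` — neither the cross term nor the fluctuation part (of any size) enters. -/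
theorem integral_abs_condExp_sub_integral_eq (ham : Measurable a) (hai : Integrable a μU) (hbm : Measurable b) (hbi : Integrable b (μU.prod μV))
    (hbx : ∀ x, Integrable (fun z => b (x, z)) μV) (hb0 : ∀ x, ∫ z, b (x, z) ∂μV = 0) (hcm : Measurable c) (hci : Integrable c μV) :
    ∫ p, |((μU.prod μV)[fun p => a p.1 + b p + c p.2 | mU.comap Prod.fst]) p - ∫ q, (a q.1 + b q + c q.2) ∂(μU.prod μV)| ∂(μU.prod μV)
      = ∫ x, |a x - ∫ y, a y ∂μU| ∂μU := by
  have hae : (fun p => |((μU.prod μV)[fun p => a p.1 + b p + c p.2 | mU.comap Prod.fst]) p - ∫ q, (a q.1 + b q + c q.2) ∂(μU.prod μV)|)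
      =ᵐ[μU.prod μV] fun p => |a p.1 - ∫ y, a y ∂μU| := by
    filter_upwards [condExp_sub_integral_ae_eq_block ham hai hbm hbi hbx hb0 hcm hci] with p hp using by rw [hp]
  rw [integral_congr_ae hae, integral_fun_fst (fun x => |a x - ∫ y, a y ∂μU|), probReal_univ, one_smul]

omit [IsProbabilityMeasure μU] in
/-- The L¹-oscillation of the block part is at most twice its L¹ size: `∫ |a − ∫a| dμU ≤ 2∫|a| dμU` — so the letter on a product law is `≤ 2∫|a|`, whatever the sizes
of the cross term and of the fluctuation part. [folklore] -/
theorem integral_abs_sub_integral_le_two_mul [IsProbabilityMeasure μU] (hai : Integrable a μU) :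
    ∫ x, |a x - ∫ y, a y ∂μU| ∂μU ≤ 2 * ∫ x, |a x| ∂μU := by
  have h1 : ∫ x, |a x - ∫ y, a y ∂μU| ∂μU ≤ ∫ x, (|a x| + |∫ y, a y ∂μU|) ∂μU :=
    integral_mono_of_nonneg (Eventually.of_forall fun _ => abs_nonneg _) (hai.abs.add (integrable_const _))
      (Eventually.of_forall fun x => abs_sub _ _)
  have h2 : ∫ x, (|a x| + |∫ y, a y ∂μU|) ∂μU = ∫ x, |a x| ∂μU + |∫ y, a y ∂μU| := by
    rw [integral_add hai.abs (integrable_const _), integral_const, probReal_univ, smul_eq_mul, one_mul]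
  have h3 : |∫ y, a y ∂μU| ≤ ∫ x, |a x| ∂μU := abs_integral_le_integral_abs
  linarith

end Product

/-- `L¹ ≤ L²` on a probability space: `∫|f| ≤ √(∫ f²)` (the variance of `|f|` is nonnegative). [folklore] -/
theorem integral_abs_le_sqrt_integral_sq {α : Type*} [MeasurableSpace α] {μ : Measure α} [IsProbabilityMeasure μ] {f : α → ℝ}
    (hfm : AEStronglyMeasurable f μ) (hf2 : Integrable (fun x => f x ^ 2) μ) :
    ∫ x, |f x| ∂μ ≤ Real.sqrt (∫ x, f x ^ 2 ∂μ) := by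
  have hmem : MemLp f 2 μ := (memLp_two_iff_integrable_sq_norm hfm).2 (by simpa only [Real.norm_eq_abs, sq_abs] using hf2)
  have hvar := variance_nonneg (|f|) μ
  rw [variance_eq_sub hmem.abs] at hvar
  have h1 : (∫ x, (|f| ^ 2) x ∂μ) = ∫ x, f x ^ 2 ∂μ := integral_congr_ae (Eventually.of_forall fun x => by simp [sq_abs])
  have h2 : (∫ x, (|f|) x ∂μ) = ∫ x, |f x| ∂μ := integral_congr_ae (Eventually.of_forall fun x => by simp)
  rw [h1, h2] at hvar
  exact Real.le_sqrt_of_sq_le (by linarith)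

/-- The transposed pairing is dominated by the Hilbert–Schmidt sum: `Σⱼₖ qⱼₖqₖⱼ ≤ Σⱼₖ qⱼₖ²` (`2xy ≤ x² + y²` + symmetry of the double sum). [folklore] -/
theorem sum_mul_transpose_le_sum_sq {ι : Type*} [Fintype ι] (q : ι → ι → ℝ) : ∑ j, ∑ k, q j k * q k j ≤ ∑ j, ∑ k, q j k ^ 2 := by
  have h1 : ∑ j, ∑ k, q j k * q k j ≤ ∑ j, ∑ k, (q j k ^ 2 + q k j ^ 2) / 2 :=
    Finset.sum_le_sum fun j _ => Finset.sum_le_sum fun k _ => by nlinarith [sq_nonneg (q j k - q k j)]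
  have h2 : ∑ j, ∑ k, (q j k ^ 2 + q k j ^ 2) / 2 = (∑ j, ∑ k, q j k ^ 2 + ∑ j, ∑ k, q k j ^ 2) / 2 := by
    rw [← Finset.sum_add_distrib, Finset.sum_div]
    refine Finset.sum_congr rfl fun j _ => ?_
    rw [← Finset.sum_add_distrib, Finset.sum_div]
  have h3 : ∑ j, ∑ k, q k j ^ 2 = ∑ j, ∑ k, q j k ^ 2 := Finset.sum_comm
  rw [h2, h3] at h1
  linarith

/-! ## §2 Gaussian moments of a bounded quadratic form `⟪u, Qu⟫`: mean `tr Q`, variance `‖Q‖²_HS + tr(Q²)`, oscillation `≤ min(2‖Q‖·dim U, √2‖Q‖_HS)` -/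
section QuadForm

variable {U : Type*} [NormedAddCommGroup U] [InnerProductSpace ℝ U] {ι : Type*} [Fintype ι]

/-- A bounded quadratic form is dominated by `‖Q‖·‖u‖²`. [folklore] -/
theorem abs_inner_clm_self_le (Q : U →L[ℝ] U) (u : U) : |⟪u, Q u⟫| ≤ ‖Q‖ * ‖u‖ ^ 2 := by
  calc |⟪u, Q u⟫| ≤ ‖u‖ * ‖Q u‖ := abs_real_inner_le_norm _ _
    _ ≤ ‖u‖ * (‖Q‖ * ‖u‖) := mul_le_mul_of_nonneg_left (Q.le_opNorm u) (norm_nonneg _)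
    _ = ‖Q‖ * ‖u‖ ^ 2 := by ring

/-- A quadratic form in orthonormal coordinates: `⟪u, Qu⟫ = Σⱼₖ qⱼₖ·uⱼuₖ`, `qⱼₖ = ⟪bⱼ, Q bₖ⟫`. [folklore] -/
theorem inner_clm_self_eq_sum_coord (b : OrthonormalBasis ι ℝ U) (Q : U →L[ℝ] U) (u : U) :
    ⟪u, Q u⟫ = ∑ j, ∑ k, ⟪b j, Q (b k)⟫ * (⟪b j, u⟫ * ⟪b k, u⟫) := by
  conv_lhs => rw [← b.sum_repr' u]
  simp only [map_sum, map_smul, sum_inner, inner_sum, real_inner_smul_left, real_inner_smul_right]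
  rw [Finset.sum_comm]
  exact Finset.sum_congr rfl fun j _ => Finset.sum_congr rfl fun k _ => by ring

/-- Its SQUARE as a quartic form: `⟪u,Qu⟫² = Σⱼₖₗₘ uⱼuₖuₗuₘ·(qⱼₖ qₗₘ)`. [folklore] -/
theorem sq_inner_clm_self_eq_sum_four (b : OrthonormalBasis ι ℝ U) (Q : U →L[ℝ] U) (u : U) :
    ⟪u, Q u⟫ ^ 2 = ∑ j, ∑ k, ∑ l, ∑ m, ⟪b j, u⟫ * ⟪b k, u⟫ * ⟪b l, u⟫ * ⟪b m, u⟫ * (⟪b j, Q (b k)⟫ * ⟪b l, Q (b m)⟫) := by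
  rw [inner_clm_self_eq_sum_coord b Q u, sq, Finset.sum_mul]
  refine Finset.sum_congr rfl fun j _ => ?_
  rw [Finset.sum_mul]
  refine Finset.sum_congr rfl fun k _ => ?_
  rw [Finset.mul_sum]
  refine Finset.sum_congr rfl fun l _ => ?_
  rw [Finset.mul_sum]
  exact Finset.sum_congr rfl fun m _ => by ring

/-- Parseval: `Σⱼₖ ⟪bⱼ, Q bₖ⟫² = Σₖ ‖Q bₖ‖²` — the HILBERT–SCHMIDT norm squared of `Q`. [folklore] -/
theorem sum_sq_inner_eq_sum_norm_sq (b : OrthonormalBasis ι ℝ U) (Q : U →L[ℝ] U) : ∑ j, ∑ k, ⟪b j, Q (b k)⟫ ^ 2 = ∑ k, ‖Q (b k)‖ ^ 2 := by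
  rw [Finset.sum_comm]
  refine Finset.sum_congr rfl fun k _ => ?_
  rw [norm_sq_eq_sum_coord_sq b (Q (b k))]
  exact Finset.sum_congr rfl fun j _ => sq _

variable [FiniteDimensional ℝ U] [MeasurableSpace U] [BorelSpace U]

/-- Gaussian second moments: `u ↦ ‖u‖²` is integrable under the standard Gaussian (Mathlib `IsGaussian.memLp_two_id`). [folklore] -/
theorem integrable_norm_sq_stdGaussian : Integrable (fun u : U => ‖u‖ ^ 2) (stdGaussian U) :=
  (memLp_two_iff_integrable_sq_norm aestronglyMeasurable_id).1 IsGaussian.memLp_two_id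

/-- A bounded quadratic form is integrable under the standard Gaussian. [folklore] -/
theorem integrable_quadForm_stdGaussian (Q : U →L[ℝ] U) : Integrable (fun u : U => ⟪u, Q u⟫) (stdGaussian U) := by
  refine (integrable_norm_sq_stdGaussian.const_mul ‖Q‖).mono' (by fun_prop) (Eventually.of_forall fun u => ?_)
  rw [Real.norm_eq_abs]
  exact abs_inner_clm_self_le Q u

/-- `∫ ‖u‖² dγ_U = dim U` (the tree's `GaussianCoordinateMoments.integral_norm_sq_stdGaussian` at the standard orthonormal basis). [folklore] -/
theorem integral_norm_sq_stdGaussian_eq_finrank : ∫ u, ‖u‖ ^ 2 ∂stdGaussian U = Module.finrank ℝ U := by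
  rw [integral_norm_sq_stdGaussian (stdOrthonormalBasis ℝ U), Fintype.card_fin]

/-- **THE OSCILLATION OF A QUADRATIC FORM, DIMENSION-DEPENDENT** [folklore]: `∫ |⟪u,Qu⟫ − ∫⟪u′,Qu′⟫| dγ_U ≤ 2·‖Q‖·dim U` (second moments only). -/
theorem integral_abs_quadForm_sub_le_two_mul (Q : U →L[ℝ] U) :
    ∫ u, |⟪u, Q u⟫ - ∫ u', ⟪u', Q u'⟫ ∂stdGaussian U| ∂stdGaussian U ≤ 2 * ‖Q‖ * Module.finrank ℝ U := by
  have h1 := integral_abs_sub_integral_le_two_mul (μU := stdGaussian U) (integrable_quadForm_stdGaussian Q)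
  have h2 : ∫ u, |⟪u, Q u⟫| ∂stdGaussian U ≤ ∫ u, ‖Q‖ * ‖u‖ ^ 2 ∂stdGaussian U :=
    integral_mono (integrable_quadForm_stdGaussian Q).abs (integrable_norm_sq_stdGaussian.const_mul ‖Q‖) fun u => abs_inner_clm_self_le Q u
  rw [integral_const_mul, integral_norm_sq_stdGaussian_eq_finrank] at h2
  linarith

variable [DecidableEq ι]

/-- **`∫ ⟪u, Qu⟫ dγ_U = Σⱼ qⱼⱼ`** in any orthonormal basis (second moments `∫ uⱼuₖ dγ = δⱼₖ` — the tree's `integral_coord_mul_coord_stdGaussian`, CITED). [folklore] -/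
theorem integral_quadForm_stdGaussian_eq_sum (b : OrthonormalBasis ι ℝ U) (Q : U →L[ℝ] U) :
    ∫ u, ⟪u, Q u⟫ ∂stdGaussian U = ∑ j, ⟪b j, Q (b j)⟫ := by
  have h : ∫ u, ⟪u, Q u⟫ ∂stdGaussian U = ∫ u, ∑ j, ∑ k, ⟪b j, Q (b k)⟫ * (⟪b j, u⟫ * ⟪b k, u⟫) ∂stdGaussian U :=
    integral_congr_ae (Eventually.of_forall fun u => inner_clm_self_eq_sum_coord b Q u)
  rw [h, integral_finsetSum _ fun j _ => integrable_finsetSum _ fun k _ => (integrable_coord_mul_coord_stdGaussian b j k).const_mul _]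
  refine Finset.sum_congr rfl fun j _ => ?_
  rw [integral_finsetSum _ fun k _ => (integrable_coord_mul_coord_stdGaussian b j k).const_mul _]
  simp_rw [integral_const_mul, integral_coord_mul_coord_stdGaussian, mul_ite, mul_one, mul_zero, Finset.sum_ite_eq, Finset.mem_univ, if_true]

omit [DecidableEq ι] in
/-- **`∫ ⟪u, Qu⟫ dγ_U = tr Q`** (Mathlib's `LinearMap.trace_eq_sum_inner`). [folklore] -/
theorem integral_quadForm_stdGaussian_eq_trace (Q : U →L[ℝ] U) : ∫ u, ⟪u, Q u⟫ ∂stdGaussian U = LinearMap.trace ℝ U (Q : U →ₗ[ℝ] U) := by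
  classical
  rw [integral_quadForm_stdGaussian_eq_sum (stdOrthonormalBasis ℝ U), LinearMap.trace_eq_sum_inner _ (stdOrthonormalBasis ℝ U)]
  rfl

/-- The square of a bounded quadratic form is integrable under the standard Gaussian (fourth moments — the tree's `integrable_coord_four_stdGaussian`). [folklore] -/
theorem integrable_sq_quadForm_stdGaussian (b : OrthonormalBasis ι ℝ U) (Q : U →L[ℝ] U) :
    Integrable (fun u : U => ⟪u, Q u⟫ ^ 2) (stdGaussian U) := by
  simp_rw [sq_inner_clm_self_eq_sum_four b Q]
  exact integrable_finsetSum _ fun j _ => integrable_finsetSum _ fun k _ => integrable_finsetSum _ fun l _ =>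
    integrable_finsetSum _ fun m _ => (integrable_coord_four_stdGaussian b j k l m).mul_const _

/-- **ISSERLIS FOR THE QUADRATIC FORM** [folklore ∘ the tree's `integral_quartForm_stdGaussian`]: `∫ ⟪u,Qu⟫² dγ_U = (Σⱼ qⱼⱼ)² + Σⱼₖ qⱼₖ² + Σⱼₖ qⱼₖqₖⱼ`. -/
theorem integral_sq_quadForm_stdGaussian (b : OrthonormalBasis ι ℝ U) (Q : U →L[ℝ] U) :
    ∫ u, ⟪u, Q u⟫ ^ 2 ∂stdGaussian U
      = (∑ j, ⟪b j, Q (b j)⟫) ^ 2 + ∑ j, ∑ k, ⟪b j, Q (b k)⟫ ^ 2 + ∑ j, ∑ k, ⟪b j, Q (b k)⟫ * ⟪b k, Q (b j)⟫ := by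
  simp_rw [sq_inner_clm_self_eq_sum_four b Q]
  rw [integral_quartForm_stdGaussian b]
  congr 2
  · rw [sq, Finset.sum_mul_sum]
  · simp_rw [sq]

/-- **THE VARIANCE OF THE QUADRATIC FORM** [folklore]: `∫ (⟪u,Qu⟫ − ∫⟪u′,Qu′⟫)² dγ_U = Σⱼₖ qⱼₖ² + Σⱼₖ qⱼₖqₖⱼ` (`= ‖Q‖²_HS + tr(Q²)`; `= 2‖Q‖²_HS` for symmetric `Q`). -/
theorem integral_sq_quadForm_sub_stdGaussian (b : OrthonormalBasis ι ℝ U) (Q : U →L[ℝ] U) :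
    ∫ u, (⟪u, Q u⟫ - ∫ u', ⟪u', Q u'⟫ ∂stdGaussian U) ^ 2 ∂stdGaussian U
      = ∑ j, ∑ k, ⟪b j, Q (b k)⟫ ^ 2 + ∑ j, ∑ k, ⟪b j, Q (b k)⟫ * ⟪b k, Q (b j)⟫ := by
  set t : ℝ := ∫ u', ⟪u', Q u'⟫ ∂stdGaussian U with ht
  have hsplit : ∀ u : U, (⟪u, Q u⟫ - t) ^ 2 = (⟪u, Q u⟫ ^ 2 - (2 * t) * ⟪u, Q u⟫) + t ^ 2 := fun u => by ring
  simp_rw [hsplit]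
  have i1 : Integrable (fun u : U => ⟪u, Q u⟫ ^ 2 - (2 * t) * ⟪u, Q u⟫) (stdGaussian U) :=
    (integrable_sq_quadForm_stdGaussian b Q).sub ((integrable_quadForm_stdGaussian Q).const_mul _)
  have e1 : ∫ u, ((⟪u, Q u⟫ ^ 2 - (2 * t) * ⟪u, Q u⟫) + t ^ 2) ∂stdGaussian U
      = ∫ u, (⟪u, Q u⟫ ^ 2 - (2 * t) * ⟪u, Q u⟫) ∂stdGaussian U + ∫ _u : U, t ^ 2 ∂stdGaussian U := integral_add i1 (integrable_const _)
  have e2 : ∫ u, (⟪u, Q u⟫ ^ 2 - (2 * t) * ⟪u, Q u⟫) ∂stdGaussian U = ∫ u, ⟪u, Q u⟫ ^ 2 ∂stdGaussian U - ∫ u, (2 * t) * ⟪u, Q u⟫ ∂stdGaussian U :=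
    integral_sub (integrable_sq_quadForm_stdGaussian b Q) ((integrable_quadForm_stdGaussian Q).const_mul _)
  have ht' : t = ∑ j, ⟪b j, Q (b j)⟫ := by rw [ht, integral_quadForm_stdGaussian_eq_sum b Q]
  rw [e1, e2, integral_const_mul, integral_const, probReal_univ, one_smul, integral_sq_quadForm_stdGaussian b Q, ← ht']
  ring

/-- **THE OSCILLATION OF A QUADRATIC FORM, DIMENSION-FREE** [folklore]: `∫ |⟪u,Qu⟫ − ∫⟪u′,Qu′⟫| dγ_U ≤ √(2·Σₖ ‖Q bₖ‖²) = √2·‖Q‖_HS`. -/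
theorem integral_abs_quadForm_sub_le_sqrt (b : OrthonormalBasis ι ℝ U) (Q : U →L[ℝ] U) :
    ∫ u, |⟪u, Q u⟫ - ∫ u', ⟪u', Q u'⟫ ∂stdGaussian U| ∂stdGaussian U ≤ Real.sqrt (2 * ∑ k, ‖Q (b k)‖ ^ 2) := by
  have hf2 : Integrable (fun u : U => (⟪u, Q u⟫ - ∫ u', ⟪u', Q u'⟫ ∂stdGaussian U) ^ 2) (stdGaussian U) := by
    have hsplit : ∀ u : U, (⟪u, Q u⟫ - ∫ u', ⟪u', Q u'⟫ ∂stdGaussian U) ^ 2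
        = (⟪u, Q u⟫ ^ 2 - (2 * ∫ u', ⟪u', Q u'⟫ ∂stdGaussian U) * ⟪u, Q u⟫) + (∫ u', ⟪u', Q u'⟫ ∂stdGaussian U) ^ 2 := fun u => by ring
    simp_rw [hsplit]
    exact ((integrable_sq_quadForm_stdGaussian b Q).sub ((integrable_quadForm_stdGaussian Q).const_mul _)).add (integrable_const _)
  refine (integral_abs_le_sqrt_integral_sq (by fun_prop) hf2).trans (Real.sqrt_le_sqrt ?_)
  rw [integral_sq_quadForm_sub_stdGaussian b Q, ← sum_sq_inner_eq_sum_norm_sq b Q, two_mul]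
  exact add_le_add le_rfl (sum_mul_transpose_le_sum_sq fun j k => ⟪b j, Q (b k)⟫)

end QuadForm

/-! ## §3 The whitened Gaussian quadratic caricature (DOOR-s11) on `U × V`: CLAIM 1 and CLAIM 2 -/
section Caricature

variable {U V : Type*} [NormedAddCommGroup U] [InnerProductSpace ℝ U] [NormedAddCommGroup V] [InnerProductSpace ℝ V] [FiniteDimensional ℝ V]
  [MeasurableSpace V] [BorelSpace V]

/-- **THE CROSS TERM HAS FIBRE MEAN ZERO** [folklore]: `∫ ⟪u, R z⟫ dγ_V(z) = 0` for every `u` — a continuous linear functional of a centred Gaussian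
(Mathlib `integral_strongDual_stdGaussian`). -/
theorem integral_inner_clm_stdGaussian_eq_zero (R : V →L[ℝ] U) (u : U) : ∫ z, ⟪u, R z⟫ ∂stdGaussian V = 0 := by
  have h : (fun z : V => ⟪u, R z⟫) = fun z => ((innerSL ℝ u).comp R) z := by ext z; simp [innerSL_apply_apply]
  rw [h]
  exact integral_strongDual_stdGaussian _

/-- The cross term is integrable along every fibre. [folklore] -/
theorem integrable_crossTerm_fibre (R : V →L[ℝ] U) (u : U) : Integrable (fun z : V => 2 * ⟪u, R z⟫) (stdGaussian V) := by
  have h : (fun z : V => 2 * ⟪u, R z⟫) = fun z => 2 * ((innerSL ℝ u).comp R) (id z) := by ext z; simp [innerSL_apply_apply]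
  rw [h]
  exact (ContinuousLinearMap.integrable_comp _ IsGaussian.integrable_id).const_mul 2

variable [FiniteDimensional ℝ U] [MeasurableSpace U] [BorelSpace U]

/-- The cross term `(u, z) ↦ 2⟪u, R z⟫` is integrable on the product of the two standard Gaussians (`2|⟪u,Rz⟫| ≤ ‖R‖(‖u‖² + ‖z‖²)`). [folklore] -/
theorem integrable_crossTerm_prod_stdGaussian (R : V →L[ℝ] U) :
    Integrable (fun p : U × V => 2 * ⟪p.1, R p.2⟫) ((stdGaussian U).prod (stdGaussian V)) := by
  have hdom : Integrable (fun p : U × V => ‖R‖ * (‖p.1‖ ^ 2 + ‖p.2‖ ^ 2)) ((stdGaussian U).prod (stdGaussian V)) :=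
    ((integrable_norm_sq_stdGaussian.comp_fst (stdGaussian V)).add (integrable_norm_sq_stdGaussian.comp_snd (stdGaussian U))).const_mul ‖R‖
  refine hdom.mono' (by fun_prop) (Eventually.of_forall fun p => ?_)
  rw [Real.norm_eq_abs, abs_mul, abs_two]
  have h1 : |⟪p.1, R p.2⟫| ≤ ‖p.1‖ * (‖R‖ * ‖p.2‖) :=
    (abs_real_inner_le_norm _ _).trans (mul_le_mul_of_nonneg_left (R.le_opNorm p.2) (norm_nonneg _))
  nlinarith [two_mul_le_add_sq ‖p.1‖ ‖p.2‖, norm_nonneg R, norm_nonneg p.1, norm_nonneg p.2]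

variable (Q₁ : U →L[ℝ] U) (R : V →L[ℝ] U) (Q₂ : V →L[ℝ] V)

/-- **CLAIM 1 AT THE CARICATURE — THE CONDITIONED QUADRATIC DEFECT** [folklore]: under `γ = stdGaussian U ⊗ stdGaussian V` (unit-field directions × fluctuation
directions, independent after whitening), the one-step defect `D(u,z) = ⟪u, Q₁u⟫ + 2⟪u, Rz⟫ + ⟪z, Q₂z⟫` conditioned on the unit field is
`γ[D | σ(fst)] = (u,z) ↦ ⟪u, Q₁u⟫ + ∫⟪z′, Q₂z′⟫ dγ_V` a.e.: the cross block `R` drops out, the fluctuation block `Q₂` becomes a constant. -/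
theorem condExp_quadDefect_ae_eq :
    ((stdGaussian U).prod (stdGaussian V))[fun p : U × V => ⟪p.1, Q₁ p.1⟫ + 2 * ⟪p.1, R p.2⟫ + ⟪p.2, Q₂ p.2⟫ | (borel U).comap Prod.fst]
      =ᵐ[(stdGaussian U).prod (stdGaussian V)] fun p => ⟪p.1, Q₁ p.1⟫ + ∫ z, ⟪z, Q₂ z⟫ ∂stdGaussian V := by
  have hB : (borel U) = (inferInstance : MeasurableSpace U) := (BorelSpace.measurable_eq (α := U)).symm
  rw [hB]
  exact condExp_prod_fst_of_fibreMeanZero (μU := stdGaussian U) (μV := stdGaussian V) (b := fun p : U × V => 2 * ⟪p.1, R p.2⟫) (by fun_prop)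
    (integrable_quadForm_stdGaussian Q₁) (by fun_prop) (integrable_crossTerm_prod_stdGaussian R) (integrable_crossTerm_fibre R)
    (fun u => by rw [integral_const_mul, integral_inner_clm_stdGaussian_eq_zero, mul_zero]) (by fun_prop) (integrable_quadForm_stdGaussian Q₂)

/-- **CLAIM 1 IN CLOSED FORM** [folklore]: `γ[D | σ(fst)] = (u,z) ↦ ⟪u, Q₁u⟫ + tr Q₂` a.e. -/
theorem condExp_quadDefect_ae_eq_trace :
    ((stdGaussian U).prod (stdGaussian V))[fun p : U × V => ⟪p.1, Q₁ p.1⟫ + 2 * ⟪p.1, R p.2⟫ + ⟪p.2, Q₂ p.2⟫ | (borel U).comap Prod.fst]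
      =ᵐ[(stdGaussian U).prod (stdGaussian V)] fun p => ⟪p.1, Q₁ p.1⟫ + LinearMap.trace ℝ V (Q₂ : V →ₗ[ℝ] V) := by
  rw [← integral_quadForm_stdGaussian_eq_trace]
  exact condExp_quadDefect_ae_eq Q₁ R Q₂

/-- **THE MEAN DEFECT IN CLOSED FORM** [folklore]: `∫ D dγ = tr Q₁ + tr Q₂` (the cross block does not enter). -/
theorem integral_quadDefect_eq_trace :
    ∫ p, (⟪p.1, Q₁ p.1⟫ + 2 * ⟪p.1, R p.2⟫ + ⟪p.2, Q₂ p.2⟫) ∂((stdGaussian U).prod (stdGaussian V))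
      = LinearMap.trace ℝ U (Q₁ : U →ₗ[ℝ] U) + LinearMap.trace ℝ V (Q₂ : V →ₗ[ℝ] V) := by
  rw [integral_crossFree_prod (μU := stdGaussian U) (μV := stdGaussian V) (b := fun p : U × V => 2 * ⟪p.1, R p.2⟫)
      (integrable_quadForm_stdGaussian Q₁) (integrable_crossTerm_prod_stdGaussian R)
      (fun u => by rw [integral_const_mul, integral_inner_clm_stdGaussian_eq_zero, mul_zero]) (integrable_quadForm_stdGaussian Q₂),
    integral_quadForm_stdGaussian_eq_trace, integral_quadForm_stdGaussian_eq_trace]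

/-- **THE LETTER AT THE CARICATURE EQUALS THE OSCILLATION OF THE UU-FORM** [folklore]:
`∫ |γ[D | σ(fst)] − γ[D]| dγ = ∫ |⟪u, Q₁u⟫ − ∫⟪u′, Q₁u′⟫ dγ_U| dγ_U`. -/
theorem integral_abs_condExp_quadDefect_sub_eq :
    ∫ p, |(((stdGaussian U).prod (stdGaussian V))[fun p : U × V => ⟪p.1, Q₁ p.1⟫ + 2 * ⟪p.1, R p.2⟫ + ⟪p.2, Q₂ p.2⟫ | (borel U).comap Prod.fst]) p -
        ∫ q, (⟪q.1, Q₁ q.1⟫ + 2 * ⟪q.1, R q.2⟫ + ⟪q.2, Q₂ q.2⟫) ∂((stdGaussian U).prod (stdGaussian V))| ∂((stdGaussian U).prod (stdGaussian V))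
      = ∫ u, |⟪u, Q₁ u⟫ - ∫ u', ⟪u', Q₁ u'⟫ ∂stdGaussian U| ∂stdGaussian U := by
  have hB : (borel U) = (inferInstance : MeasurableSpace U) := (BorelSpace.measurable_eq (α := U)).symm
  rw [hB]
  exact integral_abs_condExp_sub_integral_eq (μU := stdGaussian U) (μV := stdGaussian V) (b := fun p : U × V => 2 * ⟪p.1, R p.2⟫) (by fun_prop)
    (integrable_quadForm_stdGaussian Q₁) (by fun_prop) (integrable_crossTerm_prod_stdGaussian R) (integrable_crossTerm_fibre R)
    (fun u => by rw [integral_const_mul, integral_inner_clm_stdGaussian_eq_zero, mul_zero]) (by fun_prop) (integrable_quadForm_stdGaussian Q₂)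

/-- **CLAIM 2 — THE LOCATED INPUT AT THE CARICATURE IS THE COMPRESSED BLOCK** [folklore]: `∫ |γ[D | σ(fst)] − γ[D]| dγ ≤ 2·‖Q₁‖·dim U` — the operator norm of the
one-step defect COMPRESSED TO THE UNIT-FIELD DIRECTIONS (`Q₁ = PQP`) times the unit-lattice dimension; the cross block `R` and the fluctuation block `Q₂` (of any size) do
not enter, and `sup|D| = ∞`. -/
theorem integral_abs_condExp_quadDefect_sub_le :
    ∫ p, |(((stdGaussian U).prod (stdGaussian V))[fun p : U × V => ⟪p.1, Q₁ p.1⟫ + 2 * ⟪p.1, R p.2⟫ + ⟪p.2, Q₂ p.2⟫ | (borel U).comap Prod.fst]) p -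
        ∫ q, (⟪q.1, Q₁ q.1⟫ + 2 * ⟪q.1, R q.2⟫ + ⟪q.2, Q₂ q.2⟫) ∂((stdGaussian U).prod (stdGaussian V))| ∂((stdGaussian U).prod (stdGaussian V))
      ≤ 2 * ‖Q₁‖ * Module.finrank ℝ U := by
  rw [integral_abs_condExp_quadDefect_sub_eq]
  exact integral_abs_quadForm_sub_le_two_mul Q₁

/-- **CLAIM 2, DIMENSION-FREE** [folklore ∘ §1 + Isserlis]: in any orthonormal basis `b` of the unit-field directions,
`∫ |γ[D | σ(fst)] − γ[D]| dγ ≤ √(2·Σₖ ‖Q₁ bₖ‖²) = √2·‖PQP‖_HS` — the Hilbert–Schmidt size of the defect COMPRESSED to the unit-field block; no `dim U`. -/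
theorem integral_abs_condExp_quadDefect_sub_le_hs {ι : Type*} [Fintype ι] [DecidableEq ι] (b : OrthonormalBasis ι ℝ U) :
    ∫ p, |(((stdGaussian U).prod (stdGaussian V))[fun p : U × V => ⟪p.1, Q₁ p.1⟫ + 2 * ⟪p.1, R p.2⟫ + ⟪p.2, Q₂ p.2⟫ | (borel U).comap Prod.fst]) p -
        ∫ q, (⟪q.1, Q₁ q.1⟫ + 2 * ⟪q.1, R q.2⟫ + ⟪q.2, Q₂ q.2⟫) ∂((stdGaussian U).prod (stdGaussian V))| ∂((stdGaussian U).prod (stdGaussian V))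
      ≤ Real.sqrt (2 * ∑ k, ‖Q₁ (b k)‖ ^ 2) := by
  rw [integral_abs_condExp_quadDefect_sub_eq]
  exact integral_abs_quadForm_sub_le_sqrt b Q₁

end Caricature

end YMDAG.N14.LawChannelGaussian

end
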